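import Summits.CriticalPhenomena.PercolationContinuityZ3.Theorems.PercNearOneGluingNoHeavyLowerTailSahiSlotPairOfPinned
import Summits.CriticalPhenomena.PercolationContinuityZ3.Theorems.PercNearOneGluingNoHeavyLowerTailSahiSlotPatternTwoDim

/-!
# The simplicial column of the tensor-cone table: in dimension ONE every cell has a literal-product certificate —
# `LitProdCert 1 n`, `PinnedLitCert 1 n`, `PairLitCert 1 n` for ALL orders `n`

Support file of the one-cut programme (crux `NoHeavyLowerTail`, stmt-CriticalPhenomena-4575; cell `prim-masterthm`, seat P3, gen 22;
`run/shared/lean/prim/prim-masterthm/prim-masterthm-p3/HIERARCHY.md` §30).  Pure proofs + two bookkeeping definitions (`chainUp`, `chainLit`),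
standard axioms.

THE MATHEMATICS.  On the chain `[n]` (the slot cube `Q 1 n`) the nonempty up-sets are the final segments `{≥ m}` (`chainUp m`), and the literals
`x_0, x_1 − x_0, …, x_{n−1} − x_{n−2}` (`chainLit i`) are DUAL to them: `ℓ_i(1_{≥ m}) = [i = m]` (`eval_chainLit_chainUp`).  Hence the certificate
with one product `Π_j ℓ_{p_j}` for every choice `p : Fin n → Fin n` and coefficient `patternForm 1 n (1_{≥ p_0}, …, 1_{≥ p_{n−1}})` — nonnegative by
`SlotPatternPos 1 n` (the tree's `slotPatternPos_of_dim_le_two`) — reproduces the pattern functional on every family of up-sets (a family with an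
empty member gives `0` on both sides): **`litProdCert_dim_one : ∀ n, LitProdCert 1 n`**.  The order polytope of a chain is a simplex, so positivity
IS a literal-product certificate.  Through the format chain (`pinnedLitCert_of_litProdCert`, `pairLitCert_of_pinnedLitCert`):
`pinnedLitCert_dim_one : ∀ n, PinnedLitCert 1 n`, `pairLitCert_dim_one : ∀ n, PairLitCert 1 n`.  Also recorded: `patternForm` vanishes when a member vanishes
(`patternForm_eq_zero_of_member_eq_zero`, every `d, n`).  With `…SahiSlotTensorConeOrderTwo` (row `n = 2`, all `d`) and
`litProdCert_three_iff` (row `n = 3`: iff `d ≤ 2`) the settled part of the table reads: column `d = 1` all `n`; row `n = 2` all `d`; `(2,3)` yes; `(d ≥ 3, 3)` no.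
HONEST LABEL: dimension one only (classical); no open cell is touched. [this work]
-/

noncomputable section

namespace Summit.CriticalPhenomena.PercolationContinuityZ3.Theorems

open Finset Function
open Literature.Combinatorics.Sahi2008

namespace SahiSlot

/-! ### A general fact about the pattern functional (every `d, n`) -/

section General

variable {d n : ℕ}

/-- The pattern functional vanishes when one member is the zero function. [this work] -/
theorem patternForm_eq_zero_of_member_eq_zero (h : Fin n → Q d n → ℝ) (j : Fin n) (hj : h j = fun _ => 0) :
    patternForm d n h = 0 := by
  unfold patternForm diagForm
  refine Finset.sum_eq_zero fun τ _ => Finset.sum_eq_zero fun σ _ => ?_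
  rw [Finset.prod_eq_zero (Finset.mem_univ j) (by simp only [comp_apply, hj])]
  ring

end General

/-! ### Dimension one: final segments of the chain and their dual literals -/

section DimOne

variable {n : ℕ}

/-- The up-set `{q : q ≥ i}` (final segment) of the chain `Q 1 n`. [this work] -/
def chainUp (i : Fin n) : Finset (Q 1 n) := univ.filter fun q => i ≤ q 0

/-- `chainUp i` is an up-set. [this work] -/
theorem isUpperSet_chainUp (i : Fin n) : IsUpperSet ((chainUp i : Finset (Q 1 n)) : Set (Q 1 n)) := by
  intro q q' hqq' hq
  rw [Finset.mem_coe] at hq ⊢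
  unfold chainUp at hq ⊢
  rw [mem_filter] at hq ⊢
  exact ⟨mem_univ _, hq.2.trans (hqq' 0)⟩

/-- Indicator of a final segment. [this work] -/
theorem setInd_chainUp (i : Fin n) (q : Q 1 n) : setInd (chainUp i) q = if i ≤ q 0 then 1 else 0 := by
  simp only [setInd_apply, chainUp, mem_filter, mem_univ, true_and]

/-- **Every up-set of a chain is empty or a final segment.** [this work] -/
theorem upset_chain_cases (W : Finset (Q 1 n)) (hW : IsUpperSet ((W : Finset (Q 1 n)) : Set (Q 1 n))) :
    W = ∅ ∨ ∃ m, W = chainUp m := by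
  rcases W.eq_empty_or_nonempty with h | h
  · exact Or.inl h
  · right
    have hS : (W.image fun q => q 0).Nonempty := h.image _
    refine ⟨(W.image fun q => q 0).min' hS, ?_⟩
    ext q
    constructor
    · intro hq
      unfold chainUp
      rw [mem_filter]
      exact ⟨mem_univ _, Finset.min'_le _ _ (mem_image_of_mem _ hq)⟩
    · intro hq
      unfold chainUp at hq
      rw [mem_filter] at hq
      obtain ⟨q', hq'W, hq'0⟩ := Finset.mem_image.1 (Finset.min'_mem _ hS)
      have hle : q' ≤ q := by
        intro a
        have ha : a = 0 := Subsingleton.elim a 0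
        rw [ha, hq'0]
        exact hq.2
      exact hW hle hq'W

/-- A point of the chain, as an element of the slot cube `Q 1 n`. [this work] -/
theorem eq_const_of_Q_one (q : Q 1 n) : q = fun _ => q 0 := by
  funext a; rw [Subsingleton.elim a 0]

/-- The literal dual to the final segment `{≥ i}`: `x_0` for `i = 0`, the cut edge `x_i − x_{i−1}` for `i ≥ 1`. [this work] -/
def chainLit (i : Fin n) : Lit 1 n :=
  if (i : ℕ) = 0 then Lit.bot else Lit.cover (fun _ => ⟨(i : ℕ) - 1, by omega⟩) 0

/-- **Duality**: `ℓ_i(1_{≥ m}) = [i = m]`. [this work] -/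
theorem eval_chainLit_chainUp (i m : Fin n) : (chainLit i).eval (setInd (chainUp m)) = if i = m then 1 else 0 := by
  have hn : 0 < n := Fin.pos i
  unfold chainLit
  by_cases hi : (i : ℕ) = 0
  · rw [if_pos hi]
    show (if h : 0 < n then setInd (chainUp m) (fun _ => (⟨0, h⟩ : Fin n)) else 0) = _
    rw [dif_pos hn, setInd_chainUp]
    have : (m ≤ (⟨0, hn⟩ : Fin n)) ↔ i = m := by
      constructor
      · intro h; exact Fin.ext (by have := Fin.le_iff_val_le_val.1 h; simp at this; omega)
      · intro h; subst h; exact Fin.le_iff_val_le_val.2 (by simp [hi])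
    simp only [this]
  · rw [if_neg hi]
    have hlt : ((⟨(i : ℕ) - 1, by omega⟩ : Fin n) : ℕ) + 1 < n := by simp; omega
    show (if h : ((fun _ : Fin 1 => (⟨(i : ℕ) - 1, by omega⟩ : Fin n)) 0 : ℕ) + 1 < n then
        setInd (chainUp m) (update (fun _ : Fin 1 => (⟨(i : ℕ) - 1, by omega⟩ : Fin n)) 0 ⟨_, h⟩) -
          setInd (chainUp m) (fun _ => ⟨(i : ℕ) - 1, by omega⟩) else 0) = _
    rw [dif_pos hlt]
    have hup : update (fun _ : Fin 1 => (⟨(i : ℕ) - 1, by omega⟩ : Fin n)) 0 ⟨((⟨(i : ℕ) - 1, by omega⟩ : Fin n) : ℕ) + 1, hlt⟩ = fun _ => i := by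
      funext a
      rw [Subsingleton.elim a 0, update_self]
      exact Fin.ext (by simp; omega)
    rw [hup, setInd_chainUp, setInd_chainUp]
    by_cases him : i = m
    · subst him
      rw [if_pos le_rfl, if_neg, if_pos rfl]; · ring
      intro h; have := Fin.le_iff_val_le_val.1 h; simp at this; omega
    · rw [if_neg him]
      by_cases h1 : m ≤ i
      · have h2 : m ≤ (⟨(i : ℕ) - 1, by omega⟩ : Fin n) := by
          have := Fin.le_iff_val_le_val.1 h1
          have hne : (m : ℕ) ≠ i := fun h => him (Fin.ext h.symm)
          exact Fin.le_iff_val_le_val.2 (by simp; omega)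
        rw [if_pos h1, if_pos h2]; ring
      · have h2 : ¬ m ≤ (⟨(i : ℕ) - 1, by omega⟩ : Fin n) := by
          intro h; apply h1
          have := Fin.le_iff_val_le_val.1 h; simp at this
          exact Fin.le_iff_val_le_val.2 (by omega)
        rw [if_neg h1, if_neg h2]; ring

/-- Every chain literal vanishes on the zero function. [this work] -/
theorem eval_chainLit_zero (i : Fin n) : (chainLit i).eval (fun _ : Q 1 n => (0 : ℝ)) = 0 := by
  unfold chainLit
  split_ifs
  · show (if h : 0 < n then (0 : ℝ) else 0) = 0; split_ifs <;> rfl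
  · show (if h : _ then (0 : ℝ) - 0 else 0) = 0; split_ifs <;> ring

/-- The indicator of the empty set is the zero function. [this work] -/
theorem setInd_empty_eq : (setInd (∅ : Finset (Q 1 n)) : Q 1 n → ℝ) = fun _ => 0 := by
  funext q; simp [setInd_apply]

/-- **The simplicial column**: `LitProdCert 1 n` for every `n` — in dimension one the pattern functional of every order is a nonnegative
combination of products of literals (coefficients = its values on families of final segments). [this work] -/
theorem litProdCert_dim_one (n : ℕ) : LitProdCert 1 n := by
  classical
  have hpos : SlotPatternPos 1 n := slotPatternPos_of_dim_le_two (by norm_num) n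
  let e : (Fin n → Fin n) ≃ Fin (Fintype.card (Fin n → Fin n)) := Fintype.equivFin _
  refine ⟨Fintype.card (Fin n → Fin n), fun t => patternForm 1 n (fun j => setInd (chainUp (e.symm t j))),
    fun t j => chainLit (e.symm t j), fun t => hpos _ (fun j => isUpperSet_chainUp _), fun U hU => ?_⟩
  rw [← e.sum_comp]
  simp only [Equiv.symm_apply_apply]
  change patternForm 1 n (fun i => setInd (U i)) =
    ∑ p : Fin n → Fin n, patternForm 1 n (fun j => setInd (chainUp (p j))) * ∏ i, (chainLit (p i)).eval (setInd (U i))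
  by_cases hall : ∀ j, ∃ m, U j = chainUp m
  · choose m hm using hall
    have hUm : (fun i => setInd (U i)) = fun i => setInd (chainUp (m i)) := by funext i; rw [hm i]
    rw [hUm]
    rw [Finset.sum_eq_single m]
    · have hprod : (∏ i, (chainLit (m i)).eval (setInd (chainUp (m i)))) = 1 :=
        Finset.prod_eq_one fun i _ => by rw [eval_chainLit_chainUp, if_pos rfl]
      simp only [hm, hprod, mul_one]
    · intro p _ hp
      obtain ⟨i, hi⟩ := Function.ne_iff.mp hp
      rw [Finset.prod_eq_zero (Finset.mem_univ i) (by rw [hm i, eval_chainLit_chainUp, if_neg hi]), mul_zero]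
    · intro h; exact absurd (Finset.mem_univ m) h
  · obtain ⟨j, hj⟩ := not_forall.mp hall
    have hUj : U j = ∅ := by
      rcases upset_chain_cases (U j) (hU j) with h | ⟨m, hm⟩
      · exact h
      · exact absurd ⟨m, hm⟩ hj
    have hzero : setInd (U j) = fun _ : Q 1 n => (0 : ℝ) := by rw [hUj]; exact setInd_empty_eq
    rw [patternForm_eq_zero_of_member_eq_zero _ j hzero]
    symm
    refine Finset.sum_eq_zero fun p _ => ?_
    rw [Finset.prod_eq_zero (Finset.mem_univ j) (by rw [hzero, eval_chainLit_zero]), mul_zero]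

/-- `PinnedLitCert 1 n` for every `n`. [this work] -/
theorem pinnedLitCert_dim_one (n : ℕ) : PinnedLitCert 1 n := pinnedLitCert_of_litProdCert (litProdCert_dim_one (n + 1))

/-- `PairLitCert 1 n` for every `n` (order `n + 2`; `n = 0` from `…OrderTwo`, `n ≥ 1` through the chain). [this work] -/
theorem pairLitCert_dim_one (n : ℕ) : PairLitCert 1 n := by
  cases n with
  | zero => exact pairLitCert_zero 1
  | succ n => exact pairLitCert_of_pinnedLitCert (pinnedLitCert_dim_one (n + 2))

end DimOne

end SahiSlot

end Summit.CriticalPhenomena.PercolationContinuityZ3.Theorems
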